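import Summits.ABC.IUTFork.Joshi.TensorNormsNonArch
import Summits.ABC.IUTFork.Joshi.BundlingRingsCrossNorm
import Literature.Analysis.OperatorTheory.NonarchHahnBanach
import Mathlib.Analysis.Normed.Lp.PiLp
import HarnessLib

/-!
# [J-III] Thm 7.6.2.2 (3)(4)(5) for the norm OF PRINT (`π_max`): THEOREM for ultrametric spaces, FALSE as typed without

Companion (proof-only, 0 defs) to abc-iut-E-t14's `Joshi/TensorNormsNonArch.lean` (p430498; ns
`Summit.ABC.IUTFork.Joshi.TensorNorm`), written by the cell's foundations seat (abc-iut-found g6) on the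
strength of the classical files `Literature/Analysis/OperatorTheory/{ProjectiveTensorNormCross,
SphericallyComplete, NonarchHahnBanach}.lean` (p428374, p429154, p430497: cross-norm mechanism,
spherical completeness of `ℚ_p`, Ingleton's Hahn–Banach theorem and the bidual isometry).

POSITIVE (kernel theorems, no hypothesis beyond print's standing setting of ULTRAMETRICALLY normed spaces —
[Schneider 2002] §3 / [Perez-Garcia–Schikhof 2010] §3.1: "normed space" over a non-archimedean `K` means
`‖x + y‖ ≤ max ‖x‖ ‖y‖`):
* `maxProjNorm_tprod_padic` — `π_max(⨂ₜ[ℚ_p] m) = ∏ ‖m_i‖` for every finite family of (semi)normed ultrametric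
  `ℚ_p`-spaces (Thm 7.6.2.2 (4), and the `B_E`-form (5) at `E = ℚ_p`): Joshi's cited [Schneider 2002, Prop. 17.4];
* `maxProjNorm_tprod_of_isSphericallyComplete` — the same over any spherically complete non-archimedean field
  (every p-adic field `E`, Thm 7.6.2.2 (3): `IsSphericallyComplete.of_finiteDimensional` /
  `isSphericallyComplete_of_norm_eq_zpow`);
* `norm_tprod_padic_ultrametric` — the same for Mathlib's `π_Σ` (part 1's `CrossNormClaimQp`, ultrametric `V`).

NEGATIVE (faithfulness-of-typing evidence for E-ref, no claim about print): the three `π_max`-claims of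
`TensorNormsNonArch.lean` quantify over ALL normed `E`-spaces `V`, not only ultrametric ones, and are then FALSE:
* `not_crossNormMaxSeminormedClaim_padic`, `not_crossNormMaxClaim_padic` — at `E = ℚ_p`, `ι = Fin 1`,
  `V = ℓ¹(ℚ_p²)` (Mathlib `PiLp 1`, a Banach `ℚ_p`-space that is not ultrametric) and `m = e₀ + e₁`:
  `∏ ‖m_i‖ = ‖e₀ + e₁‖₁ = 2` but the representation `1·e₀ + 1·e₁` has max-cost `1`, so `π_max ≤ 1`
  (`π_max` of a single factor is the largest ULTRAMETRIC seminorm below `‖·‖`).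
Hence the faithful reading of (3)/(5) carries `[∀ i, IsUltrametricDist (V i)]` — under which it is the theorem above.

DOWNSTREAM (abc-iut-E-t13's chain, `BundlingRingsCrossNorm.lean` p430037): for ULTRAMETRIC factors `B_{E′_w}` (Joshi's
`|·|_{B;ρ}` are valuations, hence ultrametric) the input «Thm 7.6.2.2 (4)» of Thm 7.7.3.1-at-`p` is no longer a hypothesis:
`ATS3.PrimeBundlingDatum.crossNormAt_of_ultrametric`, `…localFundamentalEstimate_of_ultrametric` (remaining input: the
per-`w` pilot lower bound (7.7.3.3) only; completeness of the factors is not needed either).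
No side taken on [IUTchIII] Cor 3.12 or on any claim of [J-III] beyond this classical functional analysis;
typed ≠ proved for everything else in the block.
-/

noncomputable section

namespace Summit.ABC.IUTFork.Joshi.TensorNorm

open scoped TensorProduct
open PiTensorProduct Literature.Analysis.OperatorTheory

universe u v w

/-! ## Positive: the ultrametric forms are theorems -/

section Positive

variable {ι : Type v} [Fintype ι]

/-- **Thm 7.6.2.2 (4)/(5) for the norm of print, ultrametric spaces — THEOREM**: for every finite family of
seminormed ULTRAMETRIC `ℚ_p`-spaces, `π_max(⨂ₜ[ℚ_p] i, m i) = ∏ i, ‖m i‖` (E-t14's `maxProjNorm_tprod_of_bidual` +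
Ingleton's bidual isometry `Literature.Analysis.OperatorTheory.norm_inclusionInDoubleDual_eq_padic`).
[cite: PerezGarciaSchikhof2010, Cor. 4.1.2] -/
theorem maxProjNorm_tprod_padic (p : ℕ) [Fact p.Prime] {V : ι → Type w}
    [∀ i, SeminormedAddCommGroup (V i)] [∀ i, NormedSpace ℚ_[p] (V i)] [∀ i, IsUltrametricDist (V i)]
    (m : Π i, V i) : maxProjNorm (⨂ₜ[ℚ_[p]] i, m i) = ∏ i, ‖m i‖ :=
  maxProjNorm_tprod_of_bidual m fun i => norm_inclusionInDoubleDual_eq_padic p (m i)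

/-- **Thm 7.6.2.2 (3) for the norm of print, ultrametric spaces, any spherically complete non-archimedean field —
THEOREM** (covers every p-adic field `E`, spherically complete by `IsSphericallyComplete.of_finiteDimensional` or
`isSphericallyComplete_of_norm_eq_zpow`). [cite: PerezGarciaSchikhof2010, Cor. 4.1.2] -/
theorem maxProjNorm_tprod_of_isSphericallyComplete {𝕜 : Type u} [NontriviallyNormedField 𝕜]
    [IsUltrametricDist 𝕜] (h𝕜 : IsSphericallyComplete 𝕜) {V : ι → Type w}
    [∀ i, SeminormedAddCommGroup (V i)] [∀ i, NormedSpace 𝕜 (V i)] [∀ i, IsUltrametricDist (V i)]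
    (m : Π i, V i) : maxProjNorm (⨂ₜ[𝕜] i, m i) = ∏ i, ‖m i‖ :=
  maxProjNorm_tprod_of_bidual m fun i => norm_inclusionInDoubleDual_eq_of_isSphericallyComplete h𝕜 (m i)

/-- Part 1's `CrossNormClaimQp` restricted to ultrametric spaces — THEOREM for Mathlib's `π_Σ` as well
(`Literature.Analysis.OperatorTheory.norm_tprod_eq_prod_norm_padic`, restated in this namespace for the block's
consumers). [cite: PerezGarciaSchikhof2010, Cor. 4.1.2] -/
theorem norm_tprod_padic_ultrametric (p : ℕ) [Fact p.Prime] {V : ι → Type w}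
    [∀ i, SeminormedAddCommGroup (V i)] [∀ i, NormedSpace ℚ_[p] (V i)] [∀ i, IsUltrametricDist (V i)]
    (m : Π i, V i) : ‖(⨂ₜ[ℚ_[p]] i, m i)‖ = ∏ i, ‖m i‖ :=
  norm_tprod_eq_prod_norm_padic p m

end Positive

/-! ## Negative: without ultrametricity of the spaces the typed `π_max`-claims fail (at `E = ℚ_p`, `ι = Fin 1`) -/

section Negative

variable (p : ℕ) [Fact p.Prime]

/-- In `ℓ¹(ℚ_p²) = PiLp 1`, the basis vector `e_a` has norm `1`. [folklore] -/
private theorem norm_single (a : Fin 2) :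
    ‖(WithLp.toLp 1 (Pi.single a (1 : ℚ_[p])) : PiLp 1 (fun _ : Fin 2 => ℚ_[p]))‖ = 1 := by
  rw [PiLp.norm_eq_of_L1]
  simp [Fin.sum_univ_two, Pi.single_apply]
  fin_cases a <;> simp

/-- In `ℓ¹(ℚ_p²)`, `‖e₀ + e₁‖ = 2`. [folklore] -/
private theorem norm_single_add_single :
    ‖(WithLp.toLp 1 (Pi.single 0 (1 : ℚ_[p])) + WithLp.toLp 1 (Pi.single 1 (1 : ℚ_[p])) :
      PiLp 1 (fun _ : Fin 2 => ℚ_[p]))‖ = 2 := by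
  rw [← WithLp.toLp_add, PiLp.norm_eq_of_L1]
  simp [Fin.sum_univ_two, Pi.single_apply]
  norm_num

/-- On `Fin 1`, a constant family is the update at `0` of any family. [folklore] -/
private theorem const_eq_update {X : Type*} (m : Fin 1 → X) (x : X) :
    (fun _ : Fin 1 => x) = Function.update m 0 x := by
  funext j
  rw [Fin.fin_one_eq_zero j, Function.update_self]

/-- **The `π_max` of the one-factor tensor `⨂ₜ (e₀ + e₁)` over `ℓ¹(ℚ_p²)` is `≤ 1`** (representation
`1·⊗e₀ + 1·⊗e₁`, max-cost `max ‖e₀‖ ‖e₁‖ = 1`), although `‖e₀ + e₁‖ = 2`. [folklore] -/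
private theorem maxProjNorm_l1_witness_le_one :
    maxProjNorm (⨂ₜ[ℚ_[p]] (_ : Fin 1),
      ((WithLp.toLp 1 (Pi.single 0 (1 : ℚ_[p])) + WithLp.toLp 1 (Pi.single 1 (1 : ℚ_[p])) :
        PiLp 1 (fun _ : Fin 2 => ℚ_[p])))) ≤ 1 := by
  set e0 : PiLp 1 (fun _ : Fin 2 => ℚ_[p]) := WithLp.toLp 1 (Pi.single 0 (1 : ℚ_[p])) with he0
  set e1 : PiLp 1 (fun _ : Fin 2 => ℚ_[p]) := WithLp.toLp 1 (Pi.single 1 (1 : ℚ_[p])) with he1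
  -- the two-term representation
  set rep : FreeAddMonoid (ℚ_[p] × (Fin 1 → PiLp 1 (fun _ : Fin 2 => ℚ_[p]))) :=
    FreeAddMonoid.of ((1 : ℚ_[p]), fun _ => e0) + FreeAddMonoid.of ((1 : ℚ_[p]), fun _ => e1) with hrep
  have hsplit : (⨂ₜ[ℚ_[p]] (_ : Fin 1), (e0 + e1)) =
      (⨂ₜ[ℚ_[p]] (_ : Fin 1), e0) + ⨂ₜ[ℚ_[p]] (_ : Fin 1), e1 := by
    have h := (PiTensorProduct.tprod ℚ_[p]).map_update_add (fun _ : Fin 1 => e0) (0 : Fin 1) e0 e1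
    have hu : ∀ x : PiLp 1 (fun _ : Fin 2 => ℚ_[p]),
        Function.update (fun _ : Fin 1 => e0) 0 x = fun _ => x := fun x => (const_eq_update _ x).symm
    simpa only [hu] using h
  have hmem : rep ∈ lifts (⨂ₜ[ℚ_[p]] (_ : Fin 1), (e0 + e1)) := by
    rw [mem_lifts_iff, hrep, FreeAddMonoid.toList_add, FreeAddMonoid.toList_of, FreeAddMonoid.toList_of]
    simp only [List.map_cons, List.map_nil, List.singleton_append, List.sum_cons, List.sum_nil, one_smul,
      add_zero]
    exact hsplit.symm
  refine (maxProjNorm_le_maxCost hmem).trans ?_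
  refine (maxCost_le_iff zero_le_one).2 fun q hq => ?_
  rw [hrep, FreeAddMonoid.toList_add, FreeAddMonoid.toList_of, FreeAddMonoid.toList_of] at hq
  simp only [List.singleton_append, List.mem_cons, List.not_mem_nil, or_false] at hq
  rcases hq with rfl | rfl
  · simp [termCost, he0]
  · simp [termCost, he1]

/-- **`CrossNormMaxSeminormedClaim p ℚ_p` (Thm 7.6.2.2 (5)-form, `π_max`, ALL seminormed spaces) is FALSE as
typed**: witness `ι = Fin 1`, `V = ℓ¹(ℚ_p²)`, `m = e₀ + e₁` (`π_max ≤ 1 < 2 = ∏ ‖m_i‖`). With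
`[∀ i, IsUltrametricDist (V i)]` it is the theorem `maxProjNorm_tprod_padic`. [folklore] -/
theorem not_crossNormMaxSeminormedClaim_padic : ¬ CrossNormMaxSeminormedClaim.{0, 0, 0} p ℚ_[p] := by
  intro h
  have h2 := h inferInstance (Fin 1) (fun _ => PiLp 1 (fun _ : Fin 2 => ℚ_[p]))
    (fun _ => WithLp.toLp 1 (Pi.single 0 (1 : ℚ_[p])) + WithLp.toLp 1 (Pi.single 1 (1 : ℚ_[p])))
  rw [Finset.prod_const, Finset.card_univ, Fintype.card_fin, pow_one, norm_single_add_single] at h2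
  have h1 := maxProjNorm_l1_witness_le_one p
  rw [h2] at h1
  norm_num at h1

/-- **`CrossNormMaxClaim p ℚ_p` (Thm 7.6.2.2 (3)/(4)-form, `π_max`, ALL Banach spaces) is FALSE as typed** — same
witness (`ℓ¹(ℚ_p²)` is complete). With `[∀ i, IsUltrametricDist (V i)]` it is the theorem
`maxProjNorm_tprod_padic`. [folklore] -/
theorem not_crossNormMaxClaim_padic : ¬ CrossNormMaxClaim.{0, 0, 0} p ℚ_[p] := by
  intro h
  have h2 := h inferInstance (Fin 1) (fun _ => PiLp 1 (fun _ : Fin 2 => ℚ_[p])) (fun _ => inferInstance)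
    (fun _ => WithLp.toLp 1 (Pi.single 0 (1 : ℚ_[p])) + WithLp.toLp 1 (Pi.single 1 (1 : ℚ_[p])))
  rw [Finset.prod_const, Finset.card_univ, Fintype.card_fin, pow_one, norm_single_add_single] at h2
  have h1 := maxProjNorm_l1_witness_le_one p
  rw [h2] at h1
  norm_num at h1

end Negative

end Summit.ABC.IUTFork.Joshi.TensorNorm

/-! ## Downstream: E-t13's Thm 7.7.3.1-at-`p` chain without the Thm 7.6.2.2 (4) hypothesis (ultrametric factors) -/

namespace Summit.ABC.IUTFork.Joshi.ATS3.PrimeBundlingDatum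

open scoped TensorProduct

variable {lstar : ℕ} {p : ℕ} [Fact p.Prime] {Bp : Type} [CommRing Bp] [Algebra ℚ_[p] Bp] {I : Type} [Fintype I]
  [DecidableEq I] {E BE : I → Type} [∀ w, Field (E w)] [∀ w, Algebra ℚ_[p] (E w)] [∀ w, NormedCommRing (BE w)]
  [∀ w, NormedAlgebra ℚ_[p] (BE w)] [∀ w, Algebra Bp (BE w)] [∀ w, IsUltrametricDist (BE w)]
  (Vp Vss : Finset I) (hV : Vss ⊆ Vp) (toTensE : (w : I) → BE w →ₗ[ℚ_[p]] Bp ⊗[ℚ_[p]] E w)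
  (locusBE : (w : I) → Set (Fin lstar → BE w)) (qRoot : I → ℝ) (hq : ∀ w ∈ Vss, 0 < qRoot w)

/-- **(7.7.3.2) at `p` for ULTRAMETRIC factors — THEOREM, no cross-norm hypothesis**: the projective datum over `ℚ_p`
has E-t13's cross-norm property `CrossNormAt ρ` at every `ρ`, by the `p`-adic cross-norm theorem
(`Literature.Analysis.OperatorTheory.norm_tprod_eq_prod_norm_padic`, Ingleton); neither E-t14's claim (4) nor completeness
of the `B_{E′_w}` is needed. [cite: PerezGarciaSchikhof2010, Cor. 4.1.2] -/
theorem crossNormAt_of_ultrametric (ρ : ℝ) :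
    (ofProjective Vp Vss hV toTensE locusBE qRoot hq).CrossNormAt ρ :=
  crossNormAt_ofProjective Vp Vss hV toTensE locusBE qRoot hq
    (fun m => Literature.Analysis.OperatorTheory.norm_tprod_eq_prod_norm_padic p m) ρ

/-- **Thm. 7.7.3.1 at `p`, ultrametric factors — modulo the pilot lower bound ONLY**: for the literal projective-norm
datum with ultrametric `B_{E′_w}`, the per-`w` pilot lower bound (7.7.3.3) at some `ρ ∈ (0,1]` already gives
`|Θ̃^{B̆⊗}_{Joshi,p}| ≥ ∏_w |q_w^{1/2ℓ}|^{ℓ⋇}` (E-t13's `localFundamentalEstimate_of_pilot_of_crossNorm` with the cross-norm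
input DISCHARGED). Typed ≠ endorsed: (7.7.3.3) remains Joshi's claim. [cite: PerezGarciaSchikhof2010, Cor. 4.1.2] -/
theorem localFundamentalEstimate_of_ultrametric {ρ : ℝ} (hρ : ρ ∈ Set.Ioc (0 : ℝ) 1)
    (hZ : (ofProjective Vp Vss hV toTensE locusBE qRoot hq).PilotLowerBoundAt ρ) :
    (ofProjective Vp Vss hV toTensE locusBE qRoot hq).LocalFundamentalEstimate :=
  (ofProjective Vp Vss hV toTensE locusBE qRoot hq).localFundamentalEstimate_of_pilot_of_crossNorm hρ hZ
    (crossNormAt_of_ultrametric Vp Vss hV toTensE locusBE qRoot hq ρ)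

end Summit.ABC.IUTFork.Joshi.ATS3.PrimeBundlingDatum

end
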